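import Summits.MatrixMultiplication.OmegaCensus.DominoZpZpCells
import Summits.MatrixMultiplication.OmegaCensus.DominoZ7Z7Cover345
import Summits.MatrixMultiplication.OmegaCensus.DominoZ7Z7Cover6A
import Summits.MatrixMultiplication.OmegaCensus.DominoZ7Z7Cover6B
import Summits.MatrixMultiplication.OmegaCensus.DominoZ7Z7Cover6C
import HarnessLib

/-!
# No domino cube law with a part of size `3`, `4`, `5` or `6` over any `A ↠ ℤ_7 × ℤ_7`

ω-census `pub-omega`, family (b3), seat pub-omega-group gen 20.  Framing: lottery ticket; floor = certified bounds/negative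
ranges.  VALUE: kernel theorems of the `ℤ_p²`-quotient column (`p = 7`) of the Dih-side mod-one classification — the census
cells `(1,4,4)@49`, `(1,5,13)@196` ×2 groups, `(1,3,38)@343` ×2, `(1,6,19)@343` ×2, `(1,4,53)@637`,
`(1,3,87)@784` ×2, `(1,5,62)@931` and every larger order, any `c₀` — as instances of the
generic `DominoZpZpCells.lean` (cover hypotheses from the kernel enumerations `exists_table_entry_7_d`, certified line
tables `tableZ7d…`, half `η = 4`: `4 + 4 = 1` in `ZMod 7`); NOT progress on ω.

* `no_law_cube_1de_of_onto_z7z7` / `no_law_cube_1d_e_of_onto_z7z7` — parts `d ∈ {3, 4, 5, 6}` in `T` / in `U`;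
* the named cells `no_law_cube_1de_of_onto_z7z7` and `no_law_cube_1dd_of_onto_z7z7`.
-/

namespace Summit.MatrixMultiplication.OmegaCensus

open Finset ZpZpDomino Literature.Combinatorics.Additive

variable {A : Type} [AddCommGroup A] [DecidableEq A] [Fintype A] {G : Type} [Group G] [DecidableEq G]
  {ρ τ : A → G} {c₀ : A} {S T U : Finset G}

/-- `7` is prime. [folklore] -/
theorem prime_7' : Nat.Prime 7 := by decide

/-- `4` is a half in `ZMod 7`. [folklore] -/
theorem half_zmod7 : (4 : ZMod 7) + 4 = 1 := by decide

namespace ZpZpDomino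

/-- **Every value function of sum `6` on `ZMod 7 × ZMod 7` (as `49` values) in normal form has a line direction
whose count vector is a certified entry of the table.** [folklore] -/
theorem exists_table_entry_7_6 (g : Fin (7 * 7) → ℕ) (hg : ∑ i, g i = 6)
    (hNF : (1 ≤ g ⟨7, by decide⟩ ∧ 1 ≤ g ⟨1, by decide⟩) ∨
      (1 ≤ g ⟨7, by decide⟩ ∧ ∀ i : Fin (7 * 7), i.val % 7 ≠ 0 → g i = 0) ∨ (∀ i : Fin (7 * 7), i.val ≠ 0 → g i = 0)) :
    ∃ j < 7 + 1, ∃ e ∈ tableZ7d6, ∀ v < 7, e.1.getD v 0 = ∑ i : Fin (7 * 7), pick v (pv 7 j i.val) (g i) := by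
  refine exists_entry_of_cover (p := 7) (by norm_num) _ passTreeZ7d6 (sound_of_soundChk passTreeZ7d6_sound) (K := 2) (m := 7)
    (by norm_num) (fun k hk => ?_) cover_7_6_nf2 cover_7_6_nf3 ⟨7, by decide⟩ ⟨1, by decide⟩ rfl rfl g hg hNF
  interval_cases k
  · exact cover_7_6_nf1_0
  · exact cover_7_6_nf1_1
  · exact cover_7_6_nf1_2
  · exact cover_7_6_nf1_3
  · exact cover_7_6_nf1_4
  · exact cover_7_6_nf1_5
  · exact cover_7_6_nf1_6

end ZpZpDomino

/-- The cover hypothesis of `DominoZpZpCells` for `p = 7` and the part sizes with a kernel enumeration. [folklore] -/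
theorem exists_cover_z7z7 {d : ℕ} (hd : d = 3 ∨ d = 4 ∨ d = 5 ∨ d = 6) :
    ∃ Tb : List (List ℕ × List (ℕ × List ℕ)), (∀ e ∈ Tb, lineCert 7 (vecFn e.1) e.2 = true) ∧
      ∀ g : Fin (7 * 7) → ℕ, ∑ i, g i = d →
        ((1 ≤ g ⟨7, by decide⟩ ∧ 1 ≤ g ⟨1, by decide⟩) ∨ (1 ≤ g ⟨7, by decide⟩ ∧ ∀ i : Fin (7 * 7), i.val % 7 ≠ 0 → g i = 0) ∨
          (∀ i : Fin (7 * 7), i.val ≠ 0 → g i = 0)) →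
        ∃ j < 7 + 1, ∃ k : ℕ, k % 7 ≠ 0 ∧ ∃ e ∈ Tb, ∀ v < 7,
          e.1.getD (k * v % 7) 0 = ∑ i : Fin (7 * 7), pick v (pv 7 j i.val) (g i) := by
  haveI : Fact (Nat.Prime 7) := ⟨prime_7'⟩
  rcases hd with rfl | hd
  · exact ⟨tableZ7d3, tableZ7d3_cert, cover_scaled_of_unscaled exists_table_entry_7_3⟩
  rcases hd with rfl | hd
  · exact ⟨tableZ7d4, tableZ7d4_cert, cover_scaled_of_unscaled exists_table_entry_7_4⟩
  rcases hd with rfl | hd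
  · exact ⟨tableZ7d5, tableZ7d5_cert, cover_scaled_of_unscaled exists_table_entry_7_5⟩
  · subst hd
    exact ⟨tableZ7d6, tableZ7d6_cert, cover_scaled_of_unscaled exists_table_entry_7_6⟩

/-- **No `(1,1 | d,d | e,e)` law triple over `A ↠ ℤ_7 × ℤ_7` for `d ∈ {3, 4, 5, 6}`**: dihedral-like `G` over `A` (any
`c₀`), `φ : A →+ ZMod 7 × ZMod 7` onto, TPP triple with coset parts `|S₀| = |S₁| = 1`, `|T₀| = |T₁| = d`, `|U₀| = |U₁|` ⇒
`3|S||T||U| + 8 ≠ 8|A|`. [folklore] -/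
theorem no_law_cube_1de_of_onto_z7z7 {d : ℕ} (hd : d = 3 ∨ d = 4 ∨ d = 5 ∨ d = 6)
    (hρρ : ∀ a b, ρ a * ρ b = ρ (a + b)) (hρτ : ∀ a b, ρ a * τ b = τ (b - a))
    (hτρ : ∀ a b, τ a * ρ b = τ (a + b)) (hττ : ∀ a b, τ a * τ b = ρ (c₀ + b - a))
    (hρ : Function.Injective ρ) (hτ : Function.Injective τ) (hne : ∀ a b, ρ a ≠ τ b)
    (hsurj : ∀ g, (∃ a, ρ a = g) ∨ (∃ a, τ a = g))
    (φ : A →+ ZMod 7 × ZMod 7) (hφ : Function.Surjective φ)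
    (h : TripleProductProperty S T U)
    (hS₀ : (univ.filter fun a : A => ρ a ∈ S).card = 1) (hS₁ : (univ.filter fun a : A => τ a ∈ S).card = 1)
    (hT₀ : (univ.filter fun a : A => ρ a ∈ T).card = d) (hT₁ : (univ.filter fun a : A => τ a ∈ T).card = d)
    (hU : (univ.filter fun a : A => ρ a ∈ U).card = (univ.filter fun a : A => τ a ∈ U).card)
    (hV : 3 * (S.card * T.card * U.card) + 8 = 8 * Fintype.card A) : False := by
  haveI : Fact (Nat.Prime 7) := ⟨prime_7'⟩
  obtain ⟨Tb, hTb, hcov⟩ := exists_cover_z7z7 hd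
  exact no_law_cube_1de_of_onto_zpzp_of_cover (4 : ZMod 7) half_zmod7 Tb hTb ⟨7, by decide⟩ ⟨1, by decide⟩ rfl rfl hcov
    hρρ hρτ hτρ hττ hρ hτ hne hsurj φ hφ h hS₀ hS₁ hT₀ hT₁ hU hV

/-- **No `(1,1 | d,d | e,e)` law triple over `A ↠ ℤ_7 × ℤ_7` for `e ∈ {3, 4, 5, 6}`** (the small parts in `U`).
[folklore] -/
theorem no_law_cube_1d_e_of_onto_z7z7 {e : ℕ} (he : e = 3 ∨ e = 4 ∨ e = 5 ∨ e = 6)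
    (hρρ : ∀ a b, ρ a * ρ b = ρ (a + b)) (hρτ : ∀ a b, ρ a * τ b = τ (b - a))
    (hτρ : ∀ a b, τ a * ρ b = τ (a + b)) (hττ : ∀ a b, τ a * τ b = ρ (c₀ + b - a))
    (hρ : Function.Injective ρ) (hτ : Function.Injective τ) (hne : ∀ a b, ρ a ≠ τ b)
    (hsurj : ∀ g, (∃ a, ρ a = g) ∨ (∃ a, τ a = g))
    (φ : A →+ ZMod 7 × ZMod 7) (hφ : Function.Surjective φ)
    (h : TripleProductProperty S T U)
    (hS₀ : (univ.filter fun a : A => ρ a ∈ S).card = 1) (hS₁ : (univ.filter fun a : A => τ a ∈ S).card = 1)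
    (hT : (univ.filter fun a : A => ρ a ∈ T).card = (univ.filter fun a : A => τ a ∈ T).card)
    (hU₀ : (univ.filter fun a : A => ρ a ∈ U).card = e) (hU₁ : (univ.filter fun a : A => τ a ∈ U).card = e)
    (hV : 3 * (S.card * T.card * U.card) + 8 = 8 * Fintype.card A) : False := by
  haveI : Fact (Nat.Prime 7) := ⟨prime_7'⟩
  obtain ⟨Tb, hTb, hcov⟩ := exists_cover_z7z7 he
  exact no_law_cube_1d_e_of_onto_zpzp_of_cover (4 : ZMod 7) half_zmod7 Tb hTb ⟨7, by decide⟩ ⟨1, by decide⟩ rfl rfl hcov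
    hρρ hρτ hτρ hττ hρ hτ hne hsurj φ hφ h hS₀ hS₁ hT hU₀ hU₁ hV

/-- **Cell form `(1, 3, e)` over `A ↠ ℤ_7²**: no TPP triple with parts `(1,1 | 3,3 | e,e)` attains the mod-one law.
[folklore] -/
theorem no_law_cube_13e_of_onto_z7z7
    (hρρ : ∀ a b, ρ a * ρ b = ρ (a + b)) (hρτ : ∀ a b, ρ a * τ b = τ (b - a))
    (hτρ : ∀ a b, τ a * ρ b = τ (a + b)) (hττ : ∀ a b, τ a * τ b = ρ (c₀ + b - a))
    (hρ : Function.Injective ρ) (hτ : Function.Injective τ) (hne : ∀ a b, ρ a ≠ τ b)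
    (hsurj : ∀ g, (∃ a, ρ a = g) ∨ (∃ a, τ a = g))
    (φ : A →+ ZMod 7 × ZMod 7) (hφ : Function.Surjective φ)
    (h : TripleProductProperty S T U)
    (hS₀ : (univ.filter fun a : A => ρ a ∈ S).card = 1) (hS₁ : (univ.filter fun a : A => τ a ∈ S).card = 1)
    (hT₀ : (univ.filter fun a : A => ρ a ∈ T).card = 3) (hT₁ : (univ.filter fun a : A => τ a ∈ T).card = 3)
    (hU : (univ.filter fun a : A => ρ a ∈ U).card = (univ.filter fun a : A => τ a ∈ U).card)
    (hV : 3 * (S.card * T.card * U.card) + 8 = 8 * Fintype.card A) : False :=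
  no_law_cube_1de_of_onto_z7z7 (Or.inl rfl) hρρ hρτ hτρ hττ hρ hτ hne hsurj φ hφ h hS₀ hS₁ hT₀ hT₁ hU hV

/-- **Cell form `(1, d, 3)`** over `A ↠ ℤ_7²` (the parts `3` in `U`). [folklore] -/
theorem no_law_cube_1d3_of_onto_z7z7
    (hρρ : ∀ a b, ρ a * ρ b = ρ (a + b)) (hρτ : ∀ a b, ρ a * τ b = τ (b - a))
    (hτρ : ∀ a b, τ a * ρ b = τ (a + b)) (hττ : ∀ a b, τ a * τ b = ρ (c₀ + b - a))
    (hρ : Function.Injective ρ) (hτ : Function.Injective τ) (hne : ∀ a b, ρ a ≠ τ b)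
    (hsurj : ∀ g, (∃ a, ρ a = g) ∨ (∃ a, τ a = g))
    (φ : A →+ ZMod 7 × ZMod 7) (hφ : Function.Surjective φ)
    (h : TripleProductProperty S T U)
    (hS₀ : (univ.filter fun a : A => ρ a ∈ S).card = 1) (hS₁ : (univ.filter fun a : A => τ a ∈ S).card = 1)
    (hT : (univ.filter fun a : A => ρ a ∈ T).card = (univ.filter fun a : A => τ a ∈ T).card)
    (hU₀ : (univ.filter fun a : A => ρ a ∈ U).card = 3) (hU₁ : (univ.filter fun a : A => τ a ∈ U).card = 3)
    (hV : 3 * (S.card * T.card * U.card) + 8 = 8 * Fintype.card A) : False :=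
  no_law_cube_1d_e_of_onto_z7z7 (Or.inl rfl) hρρ hρτ hτρ hττ hρ hτ hne hsurj φ hφ h hS₀ hS₁ hT hU₀ hU₁ hV

/-- **Cell form `(1, 4, e)` over `A ↠ ℤ_7²**: no TPP triple with parts `(1,1 | 4,4 | e,e)` attains the mod-one law.
[folklore] -/
theorem no_law_cube_14e_of_onto_z7z7
    (hρρ : ∀ a b, ρ a * ρ b = ρ (a + b)) (hρτ : ∀ a b, ρ a * τ b = τ (b - a))
    (hτρ : ∀ a b, τ a * ρ b = τ (a + b)) (hττ : ∀ a b, τ a * τ b = ρ (c₀ + b - a))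
    (hρ : Function.Injective ρ) (hτ : Function.Injective τ) (hne : ∀ a b, ρ a ≠ τ b)
    (hsurj : ∀ g, (∃ a, ρ a = g) ∨ (∃ a, τ a = g))
    (φ : A →+ ZMod 7 × ZMod 7) (hφ : Function.Surjective φ)
    (h : TripleProductProperty S T U)
    (hS₀ : (univ.filter fun a : A => ρ a ∈ S).card = 1) (hS₁ : (univ.filter fun a : A => τ a ∈ S).card = 1)
    (hT₀ : (univ.filter fun a : A => ρ a ∈ T).card = 4) (hT₁ : (univ.filter fun a : A => τ a ∈ T).card = 4)
    (hU : (univ.filter fun a : A => ρ a ∈ U).card = (univ.filter fun a : A => τ a ∈ U).card)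
    (hV : 3 * (S.card * T.card * U.card) + 8 = 8 * Fintype.card A) : False :=
  no_law_cube_1de_of_onto_z7z7 (Or.inr (Or.inl rfl)) hρρ hρτ hτρ hττ hρ hτ hne hsurj φ hφ h hS₀ hS₁ hT₀ hT₁ hU hV

/-- **Cell form `(1, d, 4)`** over `A ↠ ℤ_7²` (the parts `4` in `U`). [folklore] -/
theorem no_law_cube_1d4_of_onto_z7z7
    (hρρ : ∀ a b, ρ a * ρ b = ρ (a + b)) (hρτ : ∀ a b, ρ a * τ b = τ (b - a))
    (hτρ : ∀ a b, τ a * ρ b = τ (a + b)) (hττ : ∀ a b, τ a * τ b = ρ (c₀ + b - a))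
    (hρ : Function.Injective ρ) (hτ : Function.Injective τ) (hne : ∀ a b, ρ a ≠ τ b)
    (hsurj : ∀ g, (∃ a, ρ a = g) ∨ (∃ a, τ a = g))
    (φ : A →+ ZMod 7 × ZMod 7) (hφ : Function.Surjective φ)
    (h : TripleProductProperty S T U)
    (hS₀ : (univ.filter fun a : A => ρ a ∈ S).card = 1) (hS₁ : (univ.filter fun a : A => τ a ∈ S).card = 1)
    (hT : (univ.filter fun a : A => ρ a ∈ T).card = (univ.filter fun a : A => τ a ∈ T).card)
    (hU₀ : (univ.filter fun a : A => ρ a ∈ U).card = 4) (hU₁ : (univ.filter fun a : A => τ a ∈ U).card = 4)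
    (hV : 3 * (S.card * T.card * U.card) + 8 = 8 * Fintype.card A) : False :=
  no_law_cube_1d_e_of_onto_z7z7 (Or.inr (Or.inl rfl)) hρρ hρτ hτρ hττ hρ hτ hne hsurj φ hφ h hS₀ hS₁ hT hU₀ hU₁ hV

/-- **Cell form `(1, 5, e)` over `A ↠ ℤ_7²**: no TPP triple with parts `(1,1 | 5,5 | e,e)` attains the mod-one law.
[folklore] -/
theorem no_law_cube_15e_of_onto_z7z7
    (hρρ : ∀ a b, ρ a * ρ b = ρ (a + b)) (hρτ : ∀ a b, ρ a * τ b = τ (b - a))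
    (hτρ : ∀ a b, τ a * ρ b = τ (a + b)) (hττ : ∀ a b, τ a * τ b = ρ (c₀ + b - a))
    (hρ : Function.Injective ρ) (hτ : Function.Injective τ) (hne : ∀ a b, ρ a ≠ τ b)
    (hsurj : ∀ g, (∃ a, ρ a = g) ∨ (∃ a, τ a = g))
    (φ : A →+ ZMod 7 × ZMod 7) (hφ : Function.Surjective φ)
    (h : TripleProductProperty S T U)
    (hS₀ : (univ.filter fun a : A => ρ a ∈ S).card = 1) (hS₁ : (univ.filter fun a : A => τ a ∈ S).card = 1)
    (hT₀ : (univ.filter fun a : A => ρ a ∈ T).card = 5) (hT₁ : (univ.filter fun a : A => τ a ∈ T).card = 5)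
    (hU : (univ.filter fun a : A => ρ a ∈ U).card = (univ.filter fun a : A => τ a ∈ U).card)
    (hV : 3 * (S.card * T.card * U.card) + 8 = 8 * Fintype.card A) : False :=
  no_law_cube_1de_of_onto_z7z7 (Or.inr (Or.inr (Or.inl rfl))) hρρ hρτ hτρ hττ hρ hτ hne hsurj φ hφ h hS₀ hS₁ hT₀ hT₁ hU hV

/-- **Cell form `(1, d, 5)`** over `A ↠ ℤ_7²` (the parts `5` in `U`). [folklore] -/
theorem no_law_cube_1d5_of_onto_z7z7
    (hρρ : ∀ a b, ρ a * ρ b = ρ (a + b)) (hρτ : ∀ a b, ρ a * τ b = τ (b - a))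
    (hτρ : ∀ a b, τ a * ρ b = τ (a + b)) (hττ : ∀ a b, τ a * τ b = ρ (c₀ + b - a))
    (hρ : Function.Injective ρ) (hτ : Function.Injective τ) (hne : ∀ a b, ρ a ≠ τ b)
    (hsurj : ∀ g, (∃ a, ρ a = g) ∨ (∃ a, τ a = g))
    (φ : A →+ ZMod 7 × ZMod 7) (hφ : Function.Surjective φ)
    (h : TripleProductProperty S T U)
    (hS₀ : (univ.filter fun a : A => ρ a ∈ S).card = 1) (hS₁ : (univ.filter fun a : A => τ a ∈ S).card = 1)
    (hT : (univ.filter fun a : A => ρ a ∈ T).card = (univ.filter fun a : A => τ a ∈ T).card)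
    (hU₀ : (univ.filter fun a : A => ρ a ∈ U).card = 5) (hU₁ : (univ.filter fun a : A => τ a ∈ U).card = 5)
    (hV : 3 * (S.card * T.card * U.card) + 8 = 8 * Fintype.card A) : False :=
  no_law_cube_1d_e_of_onto_z7z7 (Or.inr (Or.inr (Or.inl rfl))) hρρ hρτ hτρ hττ hρ hτ hne hsurj φ hφ h hS₀ hS₁ hT hU₀ hU₁ hV

/-- **Cell form `(1, 6, e)` over `A ↠ ℤ_7²**: no TPP triple with parts `(1,1 | 6,6 | e,e)` attains the mod-one law.
[folklore] -/
theorem no_law_cube_16e_of_onto_z7z7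
    (hρρ : ∀ a b, ρ a * ρ b = ρ (a + b)) (hρτ : ∀ a b, ρ a * τ b = τ (b - a))
    (hτρ : ∀ a b, τ a * ρ b = τ (a + b)) (hττ : ∀ a b, τ a * τ b = ρ (c₀ + b - a))
    (hρ : Function.Injective ρ) (hτ : Function.Injective τ) (hne : ∀ a b, ρ a ≠ τ b)
    (hsurj : ∀ g, (∃ a, ρ a = g) ∨ (∃ a, τ a = g))
    (φ : A →+ ZMod 7 × ZMod 7) (hφ : Function.Surjective φ)
    (h : TripleProductProperty S T U)
    (hS₀ : (univ.filter fun a : A => ρ a ∈ S).card = 1) (hS₁ : (univ.filter fun a : A => τ a ∈ S).card = 1)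
    (hT₀ : (univ.filter fun a : A => ρ a ∈ T).card = 6) (hT₁ : (univ.filter fun a : A => τ a ∈ T).card = 6)
    (hU : (univ.filter fun a : A => ρ a ∈ U).card = (univ.filter fun a : A => τ a ∈ U).card)
    (hV : 3 * (S.card * T.card * U.card) + 8 = 8 * Fintype.card A) : False :=
  no_law_cube_1de_of_onto_z7z7 (Or.inr (Or.inr (Or.inr rfl))) hρρ hρτ hτρ hττ hρ hτ hne hsurj φ hφ h hS₀ hS₁ hT₀ hT₁ hU hV

/-- **Cell form `(1, d, 6)`** over `A ↠ ℤ_7²` (the parts `6` in `U`). [folklore] -/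
theorem no_law_cube_1d6_of_onto_z7z7
    (hρρ : ∀ a b, ρ a * ρ b = ρ (a + b)) (hρτ : ∀ a b, ρ a * τ b = τ (b - a))
    (hτρ : ∀ a b, τ a * ρ b = τ (a + b)) (hττ : ∀ a b, τ a * τ b = ρ (c₀ + b - a))
    (hρ : Function.Injective ρ) (hτ : Function.Injective τ) (hne : ∀ a b, ρ a ≠ τ b)
    (hsurj : ∀ g, (∃ a, ρ a = g) ∨ (∃ a, τ a = g))
    (φ : A →+ ZMod 7 × ZMod 7) (hφ : Function.Surjective φ)
    (h : TripleProductProperty S T U)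
    (hS₀ : (univ.filter fun a : A => ρ a ∈ S).card = 1) (hS₁ : (univ.filter fun a : A => τ a ∈ S).card = 1)
    (hT : (univ.filter fun a : A => ρ a ∈ T).card = (univ.filter fun a : A => τ a ∈ T).card)
    (hU₀ : (univ.filter fun a : A => ρ a ∈ U).card = 6) (hU₁ : (univ.filter fun a : A => τ a ∈ U).card = 6)
    (hV : 3 * (S.card * T.card * U.card) + 8 = 8 * Fintype.card A) : False :=
  no_law_cube_1d_e_of_onto_z7z7 (Or.inr (Or.inr (Or.inr rfl))) hρρ hρτ hτρ hττ hρ hτ hne hsurj φ hφ h hS₀ hS₁ hT hU₀ hU₁ hV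

end Summit.MatrixMultiplication.OmegaCensus
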